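import Literature.MathematicalPhysics.QuantumFieldTheory.Balaban1983to89.B9Eq326OperatorAssembly
import Literature.MathematicalPhysics.QuantumFieldTheory.Balaban1983to89.B9Eq349BlockDecayAlgebra
import Literature.MathematicalPhysics.QuantumFieldTheory.Balaban1983to89.B9Eq349BlockMultipliers
import Literature.MathematicalPhysics.QuantumFieldTheory.Balaban1983to89.B9Eq349ConjugatedGreenLetters

/-!
# `Balaban1983to89.B9Eq3126H1BlockDecayOfLetters` — T. Bałaban, *Propagators for lattice gauge theories in a background field*, Commun. Math. Phys. **99**
# (1985) 389–434 [Balaban1985BackgroundPropagators] (3.49) p. 399, (3.126) p. 420, Thm 3.11 p. 416 with [Balaban1985Variational] (45) p. 285, (103) p. 293,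
# (110) p. 294 and [Balaban1984PropagatorsI] p. 38: **THE `L²` DECAY OF THE MINIMIZER'S LINEAR RESPONSE `H₁(U) = G₁(U)Q*(QG₁(U)Q*)⁻¹` FROM THE THREE LETTERS OF
# ROAD ΔA-CT** — on the one-step torus, for the assembled `H₁(U) = B9Eq326OperatorAssembly.H1ofU` (`= G1ofU ∘ Q† ∘ B11Eq103H1Complex.KinvLatticeK` by `rfl`)
# with `Q : L²(fine bonds) → L²(coarse bonds)` onto: IF `G₁(U)` has bond-block decay `(C_G, r)` (supplier: `B9Eq326DeltaABlockDecay.norm_block_G1ofU_le`,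
# `C_G = (4∕γ)e^{r}`), `Q†` has block-to-point decay `(C_Q†, r)` (a LOCAL operator: suppliers `B9Eq315QLocalLetter` ∕ `B9Eq347LocalLetterAdjoint.block_decay_of_local`,
# or §2 here from a vanishing-beyond-range letter by `B9Eq349BlockDecayAlgebra.decay_of_local`) and `(QG₁(U)Q*)⁻¹` has coarse-bond point decay `(C_K, r)`
# (supplier: `B9Eq3126QG1QInvPointDecay.norm_bondPoint_Kinv_le`, `C_K = (2∕μ₁)e^{r}`), THEN for every `0 ≤ r′ < r`
# `‖P_{y₁} ∘ H₁(U) ∘ r_{y₀}‖ ≤ C_G·C_Q†·C_K·K_d(r − r′)²·e^{−r′·d_m(y₀,y₁)}` — `B9Eq349BlockDecayAlgebra.norm_block_comp3_le_of_decay_torus` at the three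
# factors, the block ∕ point families' resolution of the identity and idempotency DISCHARGED from their pointwise characterisations (`B9Eq349BlockMultipliers`)

statement-level skeleton of published theorems with citation tags; proofs where landed; nothing here is a claim about the Yang–Mills mass gap

CITATION HEADER (lean-in-tree rule).  Audit cell `pub-balaban`, sub-cell `t4`, BINDER row NE9 (road ΔA-CT of the NE9 formalisation swarm, leaf prover 03
`b2b-balaban-t4-ne9-formalise-leaf-03` gen 76).  Imports `B9Eq326OperatorAssembly`, `B9Eq349BlockDecayAlgebra` (ne9-leaf-01 g84), `B9Eq349BlockMultipliers`
(ne9-leaf-01), `B9Eq349ConjugatedGreenLetters` (ne9-leaf-06; `norm_adjoint_apply_le'`) — all BUILT.  Sources READ first-hand: [Balaban1985BackgroundPropagators] p. 399 (3.49) («|H_k(x, y)| ≤ O(1)e^{−δ₀d(x,y)}» is PRINT's claim with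
print's `δ₀` — NOT asserted: the rate here is whatever the three letters carry, minus the composition loss `r → r′`), p. 416 Thm 3.11, p. 420 (3.126);
[Balaban1985Variational] p. 285 (45), p. 293 (103) `H₁ = G₁Q*(QG₁Q*)⁻¹`, p. 294 (110); [Balaban1984PropagatorsI] p. 38 (the three-factor shape).

WHAT IS PROVED (sorry-free; proof lane — no `def`; [folklore] composition BY NAME).
* §1 `toCLM_H1ofU_eq` (`H₁ = G₁ ∘ Q† ∘ (QG₁Q*)⁻¹` as continuous linear maps), `sum_rF_apply` ∕ `rF_idem` ∕ `sum_PB_apply` ∕ `PB_idem` (the two families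
  resolve the identity by idempotents — `B9Eq349BlockMultipliers` at `π := bpos` ∕ `π := blockCoord ∘ bpos`),
  **`norm_block_H1ofU_le_of_letters`** (the END from the three decay letters).
* §2 `norm_block_adjointQ_le_of_far` (the `Q†` letter from a vanishing-beyond-range letter `ρ_Q` and `‖Q‖ ≤ C_Q`: `(C_Q·e^{rρ_Q}, r)`),
  **`norm_block_H1ofU_le_of_far`** (the END with the `Q†` letter in that primitive form).
HONEST SCOPE.  Composition; the three decay letters are DISPLAYED (their suppliers named above are this road's files, some still in the gate's lanes); the
rate loss `r′ < r` and the square `K_d(r − r′)²` are the algebra's price; no number; NOT NE9 (cell pub-balaban: NE9 NOT PRINTED ∕ NOT PROVED; «NE9 ⇐ the named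
binders»; row WALLED ON A MODEL (O-NE9-1; #5 UNRULED); spine PROVED 0∕9; rung (B)+1 on a finite T⁴ — NOT infinite volume, NOT mass gap, NOT BetaPertH, NOT Clay;
HONEST DEPENDENCY: continuum YM on T⁴ ⇐ BetaPertH ∧ nine spine estimates (0/9 proved); BetaPertH ⇐ (D1) ∧ (D4) ∧ CAP+tail).  NEW file; nothing modified.
Net new unproved facts: 0.
-/

noncomputable section

open scoped InnerProductSpace ComplexConjugate BigOperators

namespace Literature.MathematicalPhysics.QuantumFieldTheory.Balaban1983to89.B9Eq3126H1BlockDecayOfLetters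

open B4Sect5Torus (TSite tdist)
open B4Sect5Proof (latticeConst)
open B9SectCLatticeCarrier (Bond bpos btgt)
open B9Eq311L2Pairing (WL2)
open B9Eq319QprimeTorus (fineP blockCoord)
open B11Eq103H1Complex (SiteL2K BondL2K KinvLatticeK H1LatticeK_eq)
open B9Eq310HessianOperator (adTransportW)
open B9Eq326OperatorAssembly (laplaceAofU G1ofU H1ofU)
open B9Eq349BlockDecayAlgebra (norm_block_comp3_le_of_decay_torus decay_of_local)
open B9Eq349BlockMultipliers (sum_block_apply block_comp_self opNorm_block_le)
open B9Eq349ConjugatedGreenLetters (norm_adjoint_apply_le')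

variable {d : ℕ} {L : ℕ} [NeZero L] {m : Fin d → ℕ} {𝔸 : Type*} [Ring 𝔸] [StarRing 𝔸] [Algebra ℂ 𝔸] [StarModule ℂ 𝔸]
  {W : Type*} [NormedAddCommGroup W] [InnerProductSpace ℂ W] [FiniteDimensional ℂ W] (φ : W ≃ₗ[ℂ] 𝔸)
  {c₀ c₁ : ℝ} [Fact (0 < c₀)] [Fact (0 < c₁)] (η : ℝ) (U : Bond d (fineP L m) → 𝔸ˣ) (τ : 𝔸 →ₗ[ℂ] ℂ)
  {Q : BondL2K ℂ d (fineP L m) c₀ W →ₗ[ℂ] BondL2K ℂ d m c₁ W} {a : ℝ}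
  (hpos : ∀ x : BondL2K ℂ d (fineP L m) c₀ W, x ≠ 0 → 0 < RCLike.re ⟪x, laplaceAofU L m φ η U τ Q a x⟫_ℂ) (hQs : Function.Surjective Q)
  {PB : TSite d m → BondL2K ℂ d (fineP L m) c₀ W →L[ℂ] BondL2K ℂ d (fineP L m) c₀ W}
  (hPB : ∀ (y : TSite d m) (f : BondL2K ℂ d (fineP L m) c₀ W) (b : Bond d (fineP L m)),
    WL2.equiv ℂ (fun _ : Bond d (fineP L m) => c₀) W (PB y f) b =
      if blockCoord L m (bpos b) = y then WL2.equiv ℂ (fun _ : Bond d (fineP L m) => c₀) W f b else 0)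
  {rF : TSite d m → BondL2K ℂ d m c₁ W →L[ℂ] BondL2K ℂ d m c₁ W}
  (hrF : ∀ (y : TSite d m) (g : BondL2K ℂ d m c₁ W) (b' : Bond d m),
    WL2.equiv ℂ (fun _ : Bond d m => c₁) W (rF y g) b' = if bpos b' = y then WL2.equiv ℂ (fun _ : Bond d m => c₁) W g b' else 0)

/-! ## §1 `H₁ = G₁ ∘ Q† ∘ (QG₁Q*)⁻¹` and the END from the three decay letters -/

/-- `H₁(U) = G₁(U) ∘ Q† ∘ (QG₁(U)Q*)⁻¹` as continuous linear maps (`B11Eq103H1Complex.H1LatticeK_eq`, by `rfl` at the assembled letters).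
[cite: Balaban1985Variational, (103) p.293, (45) p.285] -/
theorem toCLM_H1ofU_eq :
    LinearMap.toContinuousLinearMap (H1ofU L m φ η U τ hpos hQs) =
      LinearMap.toContinuousLinearMap (G1ofU L m φ η U τ hpos) ∘L LinearMap.toContinuousLinearMap (LinearMap.adjoint Q) ∘L
        LinearMap.toContinuousLinearMap (KinvLatticeK hpos hQs) :=
  ContinuousLinearMap.ext fun _ => rfl

omit [FiniteDimensional ℂ W] in
include hrF in
/-- the coarse-bond point family resolves the identity: `Σ_y r_y g = g`. [folklore] [cite: Balaban1985BackgroundPropagators, (3.49) p.399] -/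
theorem sum_rF_apply (g : BondL2K ℂ d m c₁ W) : ∑ y, rF y g = g :=
  sum_block_apply (π := fun b' : Bond d m => bpos b') hrF g

omit [FiniteDimensional ℂ W] in
include hrF in
/-- `r_y ∘ r_y = r_y`. [folklore] [cite: Balaban1985BackgroundPropagators, (3.49) p.399] -/
theorem rF_idem (y : TSite d m) : rF y ∘L rF y = rF y :=
  block_comp_self (π := fun b' : Bond d m => bpos b') hrF y

omit [NeZero L] [FiniteDimensional ℂ W] in
include hPB in
/-- the fine-bond block family resolves the identity: `Σ_y P_y f = f`. [folklore] [cite: Balaban1985BackgroundPropagators, (3.49) p.399 «x ∈ Δ(y)»] -/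
theorem sum_PB_apply (f : BondL2K ℂ d (fineP L m) c₀ W) : ∑ y, PB y f = f :=
  sum_block_apply (π := fun b : Bond d (fineP L m) => blockCoord L m (bpos b)) hPB f

omit [NeZero L] [FiniteDimensional ℂ W] in
include hPB in
/-- `P_y ∘ P_y = P_y`. [folklore] [cite: Balaban1985BackgroundPropagators, (3.49) p.399] -/
theorem PB_idem (y : TSite d m) : PB y ∘L PB y = PB y :=
  block_comp_self (π := fun b : Bond d (fineP L m) => blockCoord L m (bpos b)) hPB y

include hPB hrF in
/-- **THE `L²` DECAY OF `H₁(U)` FROM THE THREE LETTERS**: `G₁(U)` with bond-block decay `(C_G, r)`, `Q†` with block-to-point decay `(C_Q†, r)`, `(QG₁(U)Q*)⁻¹`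
with coarse-bond point decay `(C_K, r)`, `0 ≤ r′ < r` ⟹ `‖P_{y₁} ∘ H₁(U) ∘ r_{y₀}‖ ≤ C_G·C_Q†·C_K·K_d(r − r′)²·e^{−r′·d_m(y₀,y₁)}` — uniform in the volume `m`.
[folklore] (composition) [cite: Balaban1985BackgroundPropagators, (3.49) p.399, (3.126) p.420, Thm 3.11 p.416; Balaban1985Variational, (45) p.285, (103) p.293;
Balaban1984PropagatorsI, p.38] -/
theorem norm_block_H1ofU_le_of_letters (hm : ∀ i, 1 ≤ m i) {CG CQa CK r r' : ℝ} (hCG : 0 ≤ CG) (hCQa : 0 ≤ CQa) (hCK : 0 ≤ CK)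
    (hr' : 0 ≤ r') (hr'r : r' < r)
    (hG : ∀ z y₁, ‖PB y₁ ∘L LinearMap.toContinuousLinearMap (G1ofU L m φ η U τ hpos) ∘L PB z‖ ≤ CG * Real.exp (-(r * tdist m z y₁)))
    (hQa : ∀ z z', ‖PB z' ∘L LinearMap.toContinuousLinearMap (LinearMap.adjoint Q) ∘L rF z‖ ≤ CQa * Real.exp (-(r * tdist m z z')))
    (hK : ∀ y₀ z, ‖rF z ∘L LinearMap.toContinuousLinearMap (KinvLatticeK hpos hQs) ∘L rF y₀‖ ≤ CK * Real.exp (-(r * tdist m y₀ z)))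
    (y₀ y₁ : TSite d m) :
    ‖PB y₁ ∘L LinearMap.toContinuousLinearMap (H1ofU L m φ η U τ hpos hQs) ∘L rF y₀‖ ≤
      CG * CQa * CK * latticeConst d (r - r') ^ 2 * Real.exp (-(r' * tdist m y₀ y₁)) := by
  have h := norm_block_comp3_le_of_decay_torus hm rF (sum_rF_apply hrF) (rF_idem hrF) PB (sum_PB_apply hPB) (PB_idem hPB)
    (LinearMap.toContinuousLinearMap (G1ofU L m φ η U τ hpos)) (LinearMap.toContinuousLinearMap (LinearMap.adjoint Q))
    (LinearMap.toContinuousLinearMap (KinvLatticeK hpos hQs)) PB rF hCG hCQa hCK hr' hr'r hG hQa hK y₀ y₁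
  rw [toCLM_H1ofU_eq φ η U τ hpos hQs]
  exact h

/-! ## §2 The `Q†` letter from a vanishing-beyond-range letter -/

omit [NeZero L] in
include hPB hrF in
/-- **THE `Q†` LETTER OF A LOCAL AVERAGING**: if `P_{z′} ∘ Q† ∘ r_z = 0` whenever `d_m(z, z′) > ρ_Q` and `‖Qf‖ ≤ C_Q‖f‖`, then for every `r ≥ 0`
`‖P_{z′} ∘ Q† ∘ r_z‖ ≤ C_Q·e^{rρ_Q}·e^{−r·d_m(z,z′)}` (`‖Q†‖ = ‖Q‖`, `‖P_{z′}‖, ‖r_z‖ ≤ 1`, `B9Eq349BlockDecayAlgebra.decay_of_local`). [folklore]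
[cite: Balaban1985BackgroundPropagators, (3.15) p.393, (3.42) p.397, (3.49) p.399] -/
theorem norm_block_adjointQ_le_of_far {CQ ρQ r : ℝ} (hCQ : 0 ≤ CQ) (hr : 0 ≤ r) (hQ : ∀ f, ‖Q f‖ ≤ CQ * ‖f‖)
    (hfar : ∀ z z', ρQ < tdist m z z' → PB z' ∘L LinearMap.toContinuousLinearMap (LinearMap.adjoint Q) ∘L rF z = 0) (z z' : TSite d m) :
    ‖PB z' ∘L LinearMap.toContinuousLinearMap (LinearMap.adjoint Q) ∘L rF z‖ ≤ CQ * Real.exp (r * ρQ) * Real.exp (-(r * tdist m z z')) := by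
  have hQan : ‖LinearMap.toContinuousLinearMap (LinearMap.adjoint Q)‖ ≤ CQ :=
    ContinuousLinearMap.opNorm_le_bound _ hCQ fun g => norm_adjoint_apply_le' Q hCQ hQ g
  have hnear : ∀ z z' : TSite d m, ‖PB z' ∘L LinearMap.toContinuousLinearMap (LinearMap.adjoint Q) ∘L rF z‖ ≤ CQ := fun z z' => by
    have h1 : ‖PB z' ∘L LinearMap.toContinuousLinearMap (LinearMap.adjoint Q) ∘L rF z‖ ≤
        ‖PB z'‖ * (‖LinearMap.toContinuousLinearMap (LinearMap.adjoint Q)‖ * ‖rF z‖) :=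
      (ContinuousLinearMap.opNorm_comp_le _ _).trans
        (mul_le_mul_of_nonneg_left (ContinuousLinearMap.opNorm_comp_le _ _) (norm_nonneg _))
    have h2 : ‖PB z'‖ * (‖LinearMap.toContinuousLinearMap (LinearMap.adjoint Q)‖ * ‖rF z‖) ≤ 1 * (CQ * 1) :=
      mul_le_mul (opNorm_block_le hPB z') (mul_le_mul hQan (opNorm_block_le hrF z) (norm_nonneg _) hCQ)
        (mul_nonneg (norm_nonneg _) (norm_nonneg _)) zero_le_one
    linarith
  exact decay_of_local (δ := tdist m) (LinearMap.toContinuousLinearMap (LinearMap.adjoint Q)) PB rF hCQ hr hfar (fun z z' _ => hnear z z') z z'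

include hPB hrF in
/-- **THE `L²` DECAY OF `H₁(U)`, `Q†` LETTER IN PRIMITIVE FORM**: as `norm_block_H1ofU_le_of_letters` with the `Q†` letter supplied by §2 from
`‖Q‖ ≤ C_Q` and the range `ρ_Q`: `‖P_{y₁} ∘ H₁(U) ∘ r_{y₀}‖ ≤ C_G·(C_Q e^{rρ_Q})·C_K·K_d(r − r′)²·e^{−r′·d_m(y₀,y₁)}`. [folklore] (composition)
[cite: Balaban1985BackgroundPropagators, (3.49) p.399, (3.126) p.420, Thm 3.11 p.416; Balaban1985Variational, (45) p.285, (103) p.293; Balaban1984PropagatorsI, p.38] -/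
theorem norm_block_H1ofU_le_of_far (hm : ∀ i, 1 ≤ m i) {CG CQ CK ρQ r r' : ℝ} (hCG : 0 ≤ CG) (hCQ : 0 ≤ CQ) (hCK : 0 ≤ CK)
    (hr' : 0 ≤ r') (hr'r : r' < r) (hQ : ∀ f, ‖Q f‖ ≤ CQ * ‖f‖)
    (hfar : ∀ z z', ρQ < tdist m z z' → PB z' ∘L LinearMap.toContinuousLinearMap (LinearMap.adjoint Q) ∘L rF z = 0)
    (hG : ∀ z y₁, ‖PB y₁ ∘L LinearMap.toContinuousLinearMap (G1ofU L m φ η U τ hpos) ∘L PB z‖ ≤ CG * Real.exp (-(r * tdist m z y₁)))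
    (hK : ∀ y₀ z, ‖rF z ∘L LinearMap.toContinuousLinearMap (KinvLatticeK hpos hQs) ∘L rF y₀‖ ≤ CK * Real.exp (-(r * tdist m y₀ z)))
    (y₀ y₁ : TSite d m) :
    ‖PB y₁ ∘L LinearMap.toContinuousLinearMap (H1ofU L m φ η U τ hpos hQs) ∘L rF y₀‖ ≤
      CG * (CQ * Real.exp (r * ρQ)) * CK * latticeConst d (r - r') ^ 2 * Real.exp (-(r' * tdist m y₀ y₁)) :=
  norm_block_H1ofU_le_of_letters φ η U τ hpos hQs hPB hrF hm hCG (by positivity) hCK hr' hr'r hG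
    (norm_block_adjointQ_le_of_far hPB hrF hCQ (hr'.trans hr'r.le) hQ hfar) hK y₀ y₁

end Literature.MathematicalPhysics.QuantumFieldTheory.Balaban1983to89.B9Eq3126H1BlockDecayOfLetters

end
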